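import Summits.BirchSwinnertonDyer.BirchSwinnertonDyer.Theorems.BiquadraticEisensteinDescentManinDatumSupercuspidalCMInertSevenDivisionResolventArithmetic
import HarnessLib

set_option linter.dupNamespace false -- `Summit.BirchSwinnertonDyer.BirchSwinnertonDyer.Theorems.…` (summit = sub, D-0017)
set_option autoImplicit false

/-!
# Crux `ManinDatumSupercuspidalCMInert` (stmt-BirchSwinnertonDyer-20111, BED r605), CM side of H₇ — step (d) of memo PLAIN-ODD-57,
# fifth brick (b): `Gal(K₇/ℚ(i))` acts on `K₇ = ℚ(i)(E₀[7])` by ISOMETRIES for every valuation above `7`, TRIVIALLY on the residue ring,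
# the value group is generated by `v(t_1)`, and the tame character has exact order `48`

Route `BiquadraticEisensteinDescent` (cell `pub/bsd-wall`, width seat `bsd-wall-cm-bed-w4` g11, RESOLVENT/GALOIS LANE; `--supports`
stmt-BirchSwinnertonDyer-20111, helper). THEOREMS ONLY (no definition, no named fact, no `sorry`); BSD is not proved by any of this.

These are the hypotheses `hv`, `hres`, `hgen`, `hθ` of bed-w4 g10's `…TameResolvent.resolvent_valuation_le` for the field `K₇ ⊂ ℂ`
(`…SevenDivisionGalois`, `…SevenDivisionGaloisCount`), the valuation `v|_{K₇}` of any valuation `v` of `ℂ` with `v 7 < 1`, the group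
`Gal(K₇/ℚ(i))` and the uniformiser `t_1 = X_1/Y_1` — all read off the power basis `1, t_1, …, t_1⁴⁷` (`…SevenDivisionGaloisCount.exists_coeff_pow`,
`…ValuedPowerSums`) and the CM tame character (`…SevenDivisionTameCharacter.val_t_sub_mul_lt`):
* ★ `val_algEquiv_apply` — for `σ` acting as `P_c ↦ P_{wc}`: `v(σ x) = v(x)` and `v x ≤ 1 ⇒ v(σ x − x) < 1`;
* `exists_val_coe_eq_zpow` — `v(x) ∈ v(t_1)^ℤ` for `x ∈ K₇ˣ` (total ramification: `e = 48 = [K₇ : ℚ(i)]`, `f = 1`);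
* `dvd_fortyEight_of_forall_algEquiv` — if `(σt_1/t_1)^m ≡ 1 (mod 𝔪)` for all `σ` then `48 ∣ m` (test `σ = σ_{2+i}`).

References: [Serre1979] Ch. I §6 Prop. 17–18, Ch. IV §2 Prop. 7; [CasselsFrohlich1967] Ch. I §5–§6.
-/

noncomputable section

open scoped ComplexConjugate
open Complex PeriodPair Polynomial
open scoped PeriodPair IntermediateField BigOperators
open Literature.NumberTheory.EllipticCurves Literature.NumberTheory.EllipticCurves.GaussianLattice
open Literature.NumberTheory.LFunctions.GaussianTheta
open Literature.NumberTheory.QuadraticFields.GaussianQuarticSymbol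

namespace Summit.BirchSwinnertonDyer.BirchSwinnertonDyer.Theorems.BiquadraticEisensteinDescentManinDatumSupercuspidalCMInertSevenDivisionResolventIsometry

open Summit.BirchSwinnertonDyer.BirchSwinnertonDyer.Theorems.BiquadraticEisensteinDescentManinDatumSupercuspidalCMInertTameResolvent
open Summit.BirchSwinnertonDyer.BirchSwinnertonDyer.Theorems.BiquadraticEisensteinDescentManinDatumSupercuspidalCMInertSevenDivisionPoints
open Summit.BirchSwinnertonDyer.BirchSwinnertonDyer.Theorems.BiquadraticEisensteinDescentManinDatumSupercuspidalCMInertSevenDivisionTameCharacter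
  (val_t_sub_mul_lt)
open Summit.BirchSwinnertonDyer.BirchSwinnertonDyer.Theorems.BiquadraticEisensteinDescentManinDatumSupercuspidalCMInertSevenDivisionField
open Summit.BirchSwinnertonDyer.BirchSwinnertonDyer.Theorems.BiquadraticEisensteinDescentManinDatumSupercuspidalCMInertSevenDivisionGalois
open Summit.BirchSwinnertonDyer.BirchSwinnertonDyer.Theorems.BiquadraticEisensteinDescentManinDatumSupercuspidalCMInertSevenDivisionGaloisCount
open Summit.BirchSwinnertonDyer.BirchSwinnertonDyer.Theorems.BiquadraticEisensteinDescentManinDatumSupercuspidalCMInertValuedPowerSums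
open Summit.BirchSwinnertonDyer.BirchSwinnertonDyer.Theorems.BiquadraticEisensteinDescentManinDatumSupercuspidalCMInertSevenDivisionResolventArithmetic

section Isometry

variable {Γ₀ : Type*} [LinearOrderedCommGroupWithZero Γ₀] (v : Valuation ℂ Γ₀)

/-- Coefficients in `ℚ(i)` have values in `v(t_1)^{48ℤ}` (unramified base, `v(t_1)⁴⁸ = v 7`). [cite: Serre1979, Ch. I §6 Prop. 18] -/
theorem val_coeff_mem (h7 : v 7 < 1) (a : Fin 48 → ℚ⟮I⟯) (j : Fin 48) :
    (((a j : ℚ⟮I⟯) : ℂ)) = 0 ∨ ∃ m : ℤ, v (((a j : ℚ⟮I⟯) : ℂ)) = v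
        ((℘[ofUpperHalfPlane UpperHalfPlane.I] (((1 : GaussianInt) : ℂ) / 7) / ((Real.Gamma (1 / 4) ^ 2 / (2 * Real.sqrt (2 * Real.pi)) : ℝ) : ℂ) ^ 2) /
        (℘'[ofUpperHalfPlane UpperHalfPlane.I] (((1 : GaussianInt) : ℂ) / 7) / (2 * ((Real.Gamma (1 / 4) ^ 2 / (2 * Real.sqrt (2 * Real.pi)) : ℝ) : ℂ) ^ 3))) ^ (((48 : ℕ) : ℤ) * m) := by
  by_cases h0 : (((a j : ℚ⟮I⟯) : ℂ)) = 0
  · exact Or.inl h0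
  · right
    obtain ⟨m, hm⟩ := exists_val_eq_zpow_of_mem_adjoin_I v h7 (a j).2 h0
    refine ⟨m, ?_⟩
    rw [hm, zpow_mul, zpow_natCast]
    exact congrArg (· ^ m) (val_division v h7 not_seven_dvd_one).2.2.2.symm

/-- `↑(X_1/Y_1) = t_1`. [folklore] -/
theorem coe_t : ((((⟨_, X_mem_adjoin not_seven_dvd_one⟩ : (IntermediateField.adjoin ℚ⟮I⟯ {x : ℂ | ∃ c : GaussianInt, ¬ (7 : GaussianInt) ∣ c ∧
        (x = ℘[ofUpperHalfPlane UpperHalfPlane.I] (((c : GaussianInt) : ℂ) / 7) / ((Real.Gamma (1 / 4) ^ 2 / (2 * Real.sqrt (2 * Real.pi)) : ℝ) : ℂ) ^ 2 ∨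
         x = ℘'[ofUpperHalfPlane UpperHalfPlane.I] (((c : GaussianInt) : ℂ) / 7) / (2 * ((Real.Gamma (1 / 4) ^ 2 / (2 * Real.sqrt (2 * Real.pi)) : ℝ) : ℂ) ^ 3))})) /
             ⟨_, Y_mem_adjoin not_seven_dvd_one⟩ : (IntermediateField.adjoin ℚ⟮I⟯ {x : ℂ | ∃ c : GaussianInt, ¬ (7 : GaussianInt) ∣ c ∧
        (x = ℘[ofUpperHalfPlane UpperHalfPlane.I] (((c : GaussianInt) : ℂ) / 7) / ((Real.Gamma (1 / 4) ^ 2 / (2 * Real.sqrt (2 * Real.pi)) : ℝ) : ℂ) ^ 2 ∨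
         x = ℘'[ofUpperHalfPlane UpperHalfPlane.I] (((c : GaussianInt) : ℂ) / 7) / (2 * ((Real.Gamma (1 / 4) ^ 2 / (2 * Real.sqrt (2 * Real.pi)) : ℝ) : ℂ) ^ 3))}))) : ℂ) =
             (℘[ofUpperHalfPlane UpperHalfPlane.I] (((1 : GaussianInt) : ℂ) / 7) / ((Real.Gamma (1 / 4) ^ 2 / (2 * Real.sqrt (2 * Real.pi)) : ℝ) : ℂ) ^ 2) /
             (℘'[ofUpperHalfPlane UpperHalfPlane.I] (((1 : GaussianInt) : ℂ) / 7) / (2 * ((Real.Gamma (1 / 4) ^ 2 / (2 * Real.sqrt (2 * Real.pi)) : ℝ) : ℂ) ^ 3)) := by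
  rw [IntermediateField.coe_div]

/-- `↑(σ t_1) = t_w` when `σ` acts as `P_c ↦ P_{wc}`. [folklore] -/
theorem coe_algEquiv_t (σ : (IntermediateField.adjoin ℚ⟮I⟯ {x : ℂ | ∃ c : GaussianInt, ¬ (7 : GaussianInt) ∣ c ∧
        (x = ℘[ofUpperHalfPlane UpperHalfPlane.I] (((c : GaussianInt) : ℂ) / 7) / ((Real.Gamma (1 / 4) ^ 2 / (2 * Real.sqrt (2 * Real.pi)) : ℝ) : ℂ) ^ 2 ∨
         x = ℘'[ofUpperHalfPlane UpperHalfPlane.I] (((c : GaussianInt) : ℂ) / 7) / (2 * ((Real.Gamma (1 / 4) ^ 2 / (2 * Real.sqrt (2 * Real.pi)) : ℝ) : ℂ) ^ 3))}) ≃ₐ[ℚ⟮I⟯]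
             (IntermediateField.adjoin ℚ⟮I⟯ {x : ℂ | ∃ c : GaussianInt, ¬ (7 : GaussianInt) ∣ c ∧
        (x = ℘[ofUpperHalfPlane UpperHalfPlane.I] (((c : GaussianInt) : ℂ) / 7) / ((Real.Gamma (1 / 4) ^ 2 / (2 * Real.sqrt (2 * Real.pi)) : ℝ) : ℂ) ^ 2 ∨
         x = ℘'[ofUpperHalfPlane UpperHalfPlane.I] (((c : GaussianInt) : ℂ) / 7) / (2 * ((Real.Gamma (1 / 4) ^ 2 / (2 * Real.sqrt (2 * Real.pi)) : ℝ) : ℂ) ^ 3))})) {w : GaussianInt}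
    (hσX : ((σ ⟨_, X_mem_adjoin not_seven_dvd_one⟩ : (IntermediateField.adjoin ℚ⟮I⟯ {x : ℂ | ∃ c : GaussianInt, ¬ (7 : GaussianInt) ∣ c ∧
        (x = ℘[ofUpperHalfPlane UpperHalfPlane.I] (((c : GaussianInt) : ℂ) / 7) / ((Real.Gamma (1 / 4) ^ 2 / (2 * Real.sqrt (2 * Real.pi)) : ℝ) : ℂ) ^ 2 ∨
         x = ℘'[ofUpperHalfPlane UpperHalfPlane.I] (((c : GaussianInt) : ℂ) / 7) / (2 * ((Real.Gamma (1 / 4) ^ 2 / (2 * Real.sqrt (2 * Real.pi)) : ℝ) : ℂ) ^ 3))})) : ℂ) =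
             (℘[ofUpperHalfPlane UpperHalfPlane.I] (((w : GaussianInt) : ℂ) / 7) / ((Real.Gamma (1 / 4) ^ 2 / (2 * Real.sqrt (2 * Real.pi)) : ℝ) : ℂ) ^ 2))
    (hσY : ((σ ⟨_, Y_mem_adjoin not_seven_dvd_one⟩ : (IntermediateField.adjoin ℚ⟮I⟯ {x : ℂ | ∃ c : GaussianInt, ¬ (7 : GaussianInt) ∣ c ∧
        (x = ℘[ofUpperHalfPlane UpperHalfPlane.I] (((c : GaussianInt) : ℂ) / 7) / ((Real.Gamma (1 / 4) ^ 2 / (2 * Real.sqrt (2 * Real.pi)) : ℝ) : ℂ) ^ 2 ∨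
         x = ℘'[ofUpperHalfPlane UpperHalfPlane.I] (((c : GaussianInt) : ℂ) / 7) / (2 * ((Real.Gamma (1 / 4) ^ 2 / (2 * Real.sqrt (2 * Real.pi)) : ℝ) : ℂ) ^ 3))})) : ℂ) =
             (℘'[ofUpperHalfPlane UpperHalfPlane.I] (((w : GaussianInt) : ℂ) / 7) / (2 * ((Real.Gamma (1 / 4) ^ 2 / (2 * Real.sqrt (2 * Real.pi)) : ℝ) : ℂ) ^ 3))) :
    ((σ ((⟨_, X_mem_adjoin not_seven_dvd_one⟩ : (IntermediateField.adjoin ℚ⟮I⟯ {x : ℂ | ∃ c : GaussianInt, ¬ (7 : GaussianInt) ∣ c ∧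
        (x = ℘[ofUpperHalfPlane UpperHalfPlane.I] (((c : GaussianInt) : ℂ) / 7) / ((Real.Gamma (1 / 4) ^ 2 / (2 * Real.sqrt (2 * Real.pi)) : ℝ) : ℂ) ^ 2 ∨
         x = ℘'[ofUpperHalfPlane UpperHalfPlane.I] (((c : GaussianInt) : ℂ) / 7) / (2 * ((Real.Gamma (1 / 4) ^ 2 / (2 * Real.sqrt (2 * Real.pi)) : ℝ) : ℂ) ^ 3))})) /
             ⟨_, Y_mem_adjoin not_seven_dvd_one⟩) : (IntermediateField.adjoin ℚ⟮I⟯ {x : ℂ | ∃ c : GaussianInt, ¬ (7 : GaussianInt) ∣ c ∧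
        (x = ℘[ofUpperHalfPlane UpperHalfPlane.I] (((c : GaussianInt) : ℂ) / 7) / ((Real.Gamma (1 / 4) ^ 2 / (2 * Real.sqrt (2 * Real.pi)) : ℝ) : ℂ) ^ 2 ∨
         x = ℘'[ofUpperHalfPlane UpperHalfPlane.I] (((c : GaussianInt) : ℂ) / 7) / (2 * ((Real.Gamma (1 / 4) ^ 2 / (2 * Real.sqrt (2 * Real.pi)) : ℝ) : ℂ) ^ 3))})) : ℂ) =
             (℘[ofUpperHalfPlane UpperHalfPlane.I] (((w : GaussianInt) : ℂ) / 7) / ((Real.Gamma (1 / 4) ^ 2 / (2 * Real.sqrt (2 * Real.pi)) : ℝ) : ℂ) ^ 2) /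
             (℘'[ofUpperHalfPlane UpperHalfPlane.I] (((w : GaussianInt) : ℂ) / 7) / (2 * ((Real.Gamma (1 / 4) ^ 2 / (2 * Real.sqrt (2 * Real.pi)) : ℝ) : ℂ) ^ 3)) := by
  rw [map_div₀, IntermediateField.coe_div, hσX, hσY]

/-- ★ **`Gal(K₇/ℚ(i))` acts by isometries and trivially on the residue ring**: for `σ` acting as `P_c ↦ P_{wc}` and `x ∈ K₇`,
`v(σx) = v(x)`, and `v(x) ≤ 1 ⇒ v(σx − x) < 1` (write `x = Σ a_j t_1^j`; `σ t_1 = t_w` has the same valuation).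
[cite: Serre1979, Ch. I §6 Prop. 18, Ch. IV §2 Prop. 7] -/
theorem val_algEquiv_apply (h7 : v 7 < 1) (σ : (IntermediateField.adjoin ℚ⟮I⟯ {x : ℂ | ∃ c : GaussianInt, ¬ (7 : GaussianInt) ∣ c ∧
        (x = ℘[ofUpperHalfPlane UpperHalfPlane.I] (((c : GaussianInt) : ℂ) / 7) / ((Real.Gamma (1 / 4) ^ 2 / (2 * Real.sqrt (2 * Real.pi)) : ℝ) : ℂ) ^ 2 ∨
         x = ℘'[ofUpperHalfPlane UpperHalfPlane.I] (((c : GaussianInt) : ℂ) / 7) / (2 * ((Real.Gamma (1 / 4) ^ 2 / (2 * Real.sqrt (2 * Real.pi)) : ℝ) : ℂ) ^ 3))}) ≃ₐ[ℚ⟮I⟯]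
             (IntermediateField.adjoin ℚ⟮I⟯ {x : ℂ | ∃ c : GaussianInt, ¬ (7 : GaussianInt) ∣ c ∧
        (x = ℘[ofUpperHalfPlane UpperHalfPlane.I] (((c : GaussianInt) : ℂ) / 7) / ((Real.Gamma (1 / 4) ^ 2 / (2 * Real.sqrt (2 * Real.pi)) : ℝ) : ℂ) ^ 2 ∨
         x = ℘'[ofUpperHalfPlane UpperHalfPlane.I] (((c : GaussianInt) : ℂ) / 7) / (2 * ((Real.Gamma (1 / 4) ^ 2 / (2 * Real.sqrt (2 * Real.pi)) : ℝ) : ℂ) ^ 3))})) {w : GaussianInt}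
             (hw : ¬ (7 : GaussianInt) ∣ w)
    (hσX : ((σ ⟨_, X_mem_adjoin not_seven_dvd_one⟩ : (IntermediateField.adjoin ℚ⟮I⟯ {x : ℂ | ∃ c : GaussianInt, ¬ (7 : GaussianInt) ∣ c ∧
        (x = ℘[ofUpperHalfPlane UpperHalfPlane.I] (((c : GaussianInt) : ℂ) / 7) / ((Real.Gamma (1 / 4) ^ 2 / (2 * Real.sqrt (2 * Real.pi)) : ℝ) : ℂ) ^ 2 ∨
         x = ℘'[ofUpperHalfPlane UpperHalfPlane.I] (((c : GaussianInt) : ℂ) / 7) / (2 * ((Real.Gamma (1 / 4) ^ 2 / (2 * Real.sqrt (2 * Real.pi)) : ℝ) : ℂ) ^ 3))})) : ℂ) =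
             (℘[ofUpperHalfPlane UpperHalfPlane.I] (((w : GaussianInt) : ℂ) / 7) / ((Real.Gamma (1 / 4) ^ 2 / (2 * Real.sqrt (2 * Real.pi)) : ℝ) : ℂ) ^ 2))
    (hσY : ((σ ⟨_, Y_mem_adjoin not_seven_dvd_one⟩ : (IntermediateField.adjoin ℚ⟮I⟯ {x : ℂ | ∃ c : GaussianInt, ¬ (7 : GaussianInt) ∣ c ∧
        (x = ℘[ofUpperHalfPlane UpperHalfPlane.I] (((c : GaussianInt) : ℂ) / 7) / ((Real.Gamma (1 / 4) ^ 2 / (2 * Real.sqrt (2 * Real.pi)) : ℝ) : ℂ) ^ 2 ∨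
         x = ℘'[ofUpperHalfPlane UpperHalfPlane.I] (((c : GaussianInt) : ℂ) / 7) / (2 * ((Real.Gamma (1 / 4) ^ 2 / (2 * Real.sqrt (2 * Real.pi)) : ℝ) : ℂ) ^ 3))})) : ℂ) =
             (℘'[ofUpperHalfPlane UpperHalfPlane.I] (((w : GaussianInt) : ℂ) / 7) / (2 * ((Real.Gamma (1 / 4) ^ 2 / (2 * Real.sqrt (2 * Real.pi)) : ℝ) : ℂ) ^ 3)))
             (x : (IntermediateField.adjoin ℚ⟮I⟯ {x : ℂ | ∃ c : GaussianInt, ¬ (7 : GaussianInt) ∣ c ∧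
        (x = ℘[ofUpperHalfPlane UpperHalfPlane.I] (((c : GaussianInt) : ℂ) / 7) / ((Real.Gamma (1 / 4) ^ 2 / (2 * Real.sqrt (2 * Real.pi)) : ℝ) : ℂ) ^ 2 ∨
         x = ℘'[ofUpperHalfPlane UpperHalfPlane.I] (((c : GaussianInt) : ℂ) / 7) / (2 * ((Real.Gamma (1 / 4) ^ 2 / (2 * Real.sqrt (2 * Real.pi)) : ℝ) : ℂ) ^ 3))})) :
    v ((σ x : (IntermediateField.adjoin ℚ⟮I⟯ {x : ℂ | ∃ c : GaussianInt, ¬ (7 : GaussianInt) ∣ c ∧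
        (x = ℘[ofUpperHalfPlane UpperHalfPlane.I] (((c : GaussianInt) : ℂ) / 7) / ((Real.Gamma (1 / 4) ^ 2 / (2 * Real.sqrt (2 * Real.pi)) : ℝ) : ℂ) ^ 2 ∨
         x = ℘'[ofUpperHalfPlane UpperHalfPlane.I] (((c : GaussianInt) : ℂ) / 7) / (2 * ((Real.Gamma (1 / 4) ^ 2 / (2 * Real.sqrt (2 * Real.pi)) : ℝ) : ℂ) ^ 3))})) : ℂ) = v (x : ℂ) ∧
             (v (x : ℂ) ≤ 1 → v (((σ x - x : (IntermediateField.adjoin ℚ⟮I⟯ {x : ℂ | ∃ c : GaussianInt, ¬ (7 : GaussianInt) ∣ c ∧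
        (x = ℘[ofUpperHalfPlane UpperHalfPlane.I] (((c : GaussianInt) : ℂ) / 7) / ((Real.Gamma (1 / 4) ^ 2 / (2 * Real.sqrt (2 * Real.pi)) : ℝ) : ℂ) ^ 2 ∨
         x = ℘'[ofUpperHalfPlane UpperHalfPlane.I] (((c : GaussianInt) : ℂ) / 7) / (2 * ((Real.Gamma (1 / 4) ^ 2 / (2 * Real.sqrt (2 * Real.pi)) : ℝ) : ℂ) ^ 3))}))) : ℂ) < 1) := by
  obtain ⟨hr0, hr1⟩ := val_t_lt_one v h7 not_seven_dvd_one
  have hrw : v ((℘[ofUpperHalfPlane UpperHalfPlane.I] (((w : GaussianInt) : ℂ) / 7) / ((Real.Gamma (1 / 4) ^ 2 / (2 * Real.sqrt (2 * Real.pi)) : ℝ) : ℂ) ^ 2) /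
      (℘'[ofUpperHalfPlane UpperHalfPlane.I] (((w : GaussianInt) : ℂ) / 7) / (2 * ((Real.Gamma (1 / 4) ^ 2 / (2 * Real.sqrt (2 * Real.pi)) : ℝ) : ℂ) ^ 3))) = v
      ((℘[ofUpperHalfPlane UpperHalfPlane.I] (((1 : GaussianInt) : ℂ) / 7) / ((Real.Gamma (1 / 4) ^ 2 / (2 * Real.sqrt (2 * Real.pi)) : ℝ) : ℂ) ^ 2) /
      (℘'[ofUpperHalfPlane UpperHalfPlane.I] (((1 : GaussianInt) : ℂ) / 7) / (2 * ((Real.Gamma (1 / 4) ^ 2 / (2 * Real.sqrt (2 * Real.pi)) : ℝ) : ℂ) ^ 3))) := val_t_eq v h7 hw not_seven_dvd_one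
  obtain ⟨a, rfl⟩ := exists_coeff_pow v h7 x
  constructor
  · rw [algEquiv_sum_smul_pow, coe_sum_smul_pow, coe_sum_smul_pow, coe_algEquiv_t σ hσX hσY, coe_t]
    exact val_sum_mul_pow_eq_of_val_eq v hr0 hr1 rfl hrw _ (val_coeff_mem v h7 a)
  · intro hx
    rw [coe_sum_smul_pow, coe_t] at hx
    have heq : σ (∑ j : Fin 48, a j • ((⟨_, X_mem_adjoin not_seven_dvd_one⟩ : (IntermediateField.adjoin ℚ⟮I⟯ {x : ℂ | ∃ c : GaussianInt, ¬ (7 : GaussianInt) ∣ c ∧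
        (x = ℘[ofUpperHalfPlane UpperHalfPlane.I] (((c : GaussianInt) : ℂ) / 7) / ((Real.Gamma (1 / 4) ^ 2 / (2 * Real.sqrt (2 * Real.pi)) : ℝ) : ℂ) ^ 2 ∨
         x = ℘'[ofUpperHalfPlane UpperHalfPlane.I] (((c : GaussianInt) : ℂ) / 7) / (2 * ((Real.Gamma (1 / 4) ^ 2 / (2 * Real.sqrt (2 * Real.pi)) : ℝ) : ℂ) ^ 3))})) /
             ⟨_, Y_mem_adjoin not_seven_dvd_one⟩) ^ (j : ℕ)) -
        ∑ j : Fin 48, a j • ((⟨_, X_mem_adjoin not_seven_dvd_one⟩ : (IntermediateField.adjoin ℚ⟮I⟯ {x : ℂ | ∃ c : GaussianInt, ¬ (7 : GaussianInt) ∣ c ∧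
        (x = ℘[ofUpperHalfPlane UpperHalfPlane.I] (((c : GaussianInt) : ℂ) / 7) / ((Real.Gamma (1 / 4) ^ 2 / (2 * Real.sqrt (2 * Real.pi)) : ℝ) : ℂ) ^ 2 ∨
         x = ℘'[ofUpperHalfPlane UpperHalfPlane.I] (((c : GaussianInt) : ℂ) / 7) / (2 * ((Real.Gamma (1 / 4) ^ 2 / (2 * Real.sqrt (2 * Real.pi)) : ℝ) : ℂ) ^ 3))})) /
             ⟨_, Y_mem_adjoin not_seven_dvd_one⟩) ^ (j : ℕ) =
        ∑ j : Fin 48, a j • ((σ ((⟨_, X_mem_adjoin not_seven_dvd_one⟩ : (IntermediateField.adjoin ℚ⟮I⟯ {x : ℂ | ∃ c : GaussianInt, ¬ (7 : GaussianInt) ∣ c ∧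
        (x = ℘[ofUpperHalfPlane UpperHalfPlane.I] (((c : GaussianInt) : ℂ) / 7) / ((Real.Gamma (1 / 4) ^ 2 / (2 * Real.sqrt (2 * Real.pi)) : ℝ) : ℂ) ^ 2 ∨
         x = ℘'[ofUpperHalfPlane UpperHalfPlane.I] (((c : GaussianInt) : ℂ) / 7) / (2 * ((Real.Gamma (1 / 4) ^ 2 / (2 * Real.sqrt (2 * Real.pi)) : ℝ) : ℂ) ^ 3))})) /
             ⟨_, Y_mem_adjoin not_seven_dvd_one⟩)) ^ (j : ℕ) -
          ((⟨_, X_mem_adjoin not_seven_dvd_one⟩ : (IntermediateField.adjoin ℚ⟮I⟯ {x : ℂ | ∃ c : GaussianInt, ¬ (7 : GaussianInt) ∣ c ∧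
        (x = ℘[ofUpperHalfPlane UpperHalfPlane.I] (((c : GaussianInt) : ℂ) / 7) / ((Real.Gamma (1 / 4) ^ 2 / (2 * Real.sqrt (2 * Real.pi)) : ℝ) : ℂ) ^ 2 ∨
         x = ℘'[ofUpperHalfPlane UpperHalfPlane.I] (((c : GaussianInt) : ℂ) / 7) / (2 * ((Real.Gamma (1 / 4) ^ 2 / (2 * Real.sqrt (2 * Real.pi)) : ℝ) : ℂ) ^ 3))})) /
             ⟨_, Y_mem_adjoin not_seven_dvd_one⟩) ^ (j : ℕ)) := by
      rw [algEquiv_sum_smul_pow, ← Finset.sum_sub_distrib]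
      refine Finset.sum_congr rfl fun j _ ↦ ?_
      rw [smul_sub]
    have hcoe2 : (((∑ j : Fin 48, a j • ((σ ((⟨_, X_mem_adjoin not_seven_dvd_one⟩ : (IntermediateField.adjoin ℚ⟮I⟯ {x : ℂ | ∃ c : GaussianInt, ¬ (7 : GaussianInt) ∣ c ∧
        (x = ℘[ofUpperHalfPlane UpperHalfPlane.I] (((c : GaussianInt) : ℂ) / 7) / ((Real.Gamma (1 / 4) ^ 2 / (2 * Real.sqrt (2 * Real.pi)) : ℝ) : ℂ) ^ 2 ∨
         x = ℘'[ofUpperHalfPlane UpperHalfPlane.I] (((c : GaussianInt) : ℂ) / 7) / (2 * ((Real.Gamma (1 / 4) ^ 2 / (2 * Real.sqrt (2 * Real.pi)) : ℝ) : ℂ) ^ 3))})) /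
             ⟨_, Y_mem_adjoin not_seven_dvd_one⟩)) ^ (j : ℕ) -
          ((⟨_, X_mem_adjoin not_seven_dvd_one⟩ : (IntermediateField.adjoin ℚ⟮I⟯ {x : ℂ | ∃ c : GaussianInt, ¬ (7 : GaussianInt) ∣ c ∧
        (x = ℘[ofUpperHalfPlane UpperHalfPlane.I] (((c : GaussianInt) : ℂ) / 7) / ((Real.Gamma (1 / 4) ^ 2 / (2 * Real.sqrt (2 * Real.pi)) : ℝ) : ℂ) ^ 2 ∨
         x = ℘'[ofUpperHalfPlane UpperHalfPlane.I] (((c : GaussianInt) : ℂ) / 7) / (2 * ((Real.Gamma (1 / 4) ^ 2 / (2 * Real.sqrt (2 * Real.pi)) : ℝ) : ℂ) ^ 3))})) /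
             ⟨_, Y_mem_adjoin not_seven_dvd_one⟩) ^ (j : ℕ)) : (IntermediateField.adjoin ℚ⟮I⟯ {x : ℂ | ∃ c : GaussianInt, ¬ (7 : GaussianInt) ∣ c ∧
        (x = ℘[ofUpperHalfPlane UpperHalfPlane.I] (((c : GaussianInt) : ℂ) / 7) / ((Real.Gamma (1 / 4) ^ 2 / (2 * Real.sqrt (2 * Real.pi)) : ℝ) : ℂ) ^ 2 ∨
         x = ℘'[ofUpperHalfPlane UpperHalfPlane.I] (((c : GaussianInt) : ℂ) / 7) / (2 * ((Real.Gamma (1 / 4) ^ 2 / (2 * Real.sqrt (2 * Real.pi)) : ℝ) : ℂ) ^ 3))}))) : ℂ) =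
        ∑ j : Fin 48, (((a j : ℚ⟮I⟯) : ℂ)) *
            (((℘[ofUpperHalfPlane UpperHalfPlane.I] (((w : GaussianInt) : ℂ) / 7) / ((Real.Gamma (1 / 4) ^ 2 / (2 * Real.sqrt (2 * Real.pi)) : ℝ) : ℂ) ^ 2) /
            (℘'[ofUpperHalfPlane UpperHalfPlane.I] (((w : GaussianInt) : ℂ) / 7) / (2 * ((Real.Gamma (1 / 4) ^ 2 / (2 * Real.sqrt (2 * Real.pi)) : ℝ) : ℂ) ^ 3))) ^ (j : ℕ) -
            ((℘[ofUpperHalfPlane UpperHalfPlane.I] (((1 : GaussianInt) : ℂ) / 7) / ((Real.Gamma (1 / 4) ^ 2 / (2 * Real.sqrt (2 * Real.pi)) : ℝ) : ℂ) ^ 2) /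
            (℘'[ofUpperHalfPlane UpperHalfPlane.I] (((1 : GaussianInt) : ℂ) / 7) / (2 * ((Real.Gamma (1 / 4) ^ 2 / (2 * Real.sqrt (2 * Real.pi)) : ℝ) : ℂ) ^ 3))) ^ (j : ℕ)) := by
      rw [IntermediateField.coe_sum]
      refine Finset.sum_congr rfl fun j _ ↦ ?_
      rw [IntermediateField.coe_smul, Algebra.smul_def, AddSubgroupClass.coe_sub, IntermediateField.coe_pow,
        IntermediateField.coe_pow, coe_algEquiv_t σ hσX hσY, coe_t]
      rfl
    rw [heq, hcoe2]
    exact val_sum_mul_pow_sub_lt_one v hr0 hr1 rfl hrw _ (val_coeff_mem v h7 a) hx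

/-- **The value group of `v|_{K₇}` is generated by `v(t_1)`** (`e = 48 = [K₇ : ℚ(i)]`, `f = 1`). [cite: Serre1979, Ch. I §6 Prop. 18] -/
theorem exists_val_coe_eq_zpow (h7 : v 7 < 1) {x : (IntermediateField.adjoin ℚ⟮I⟯ {x : ℂ | ∃ c : GaussianInt, ¬ (7 : GaussianInt) ∣ c ∧
        (x = ℘[ofUpperHalfPlane UpperHalfPlane.I] (((c : GaussianInt) : ℂ) / 7) / ((Real.Gamma (1 / 4) ^ 2 / (2 * Real.sqrt (2 * Real.pi)) : ℝ) : ℂ) ^ 2 ∨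
         x = ℘'[ofUpperHalfPlane UpperHalfPlane.I] (((c : GaussianInt) : ℂ) / 7) / (2 * ((Real.Gamma (1 / 4) ^ 2 / (2 * Real.sqrt (2 * Real.pi)) : ℝ) : ℂ) ^ 3))})} (hx : x ≠ 0) : ∃ m : ℤ, v
             (x : ℂ) = v ((℘[ofUpperHalfPlane UpperHalfPlane.I] (((1 : GaussianInt) : ℂ) / 7) / ((Real.Gamma (1 / 4) ^ 2 / (2 * Real.sqrt (2 * Real.pi)) : ℝ) : ℂ) ^ 2) /
             (℘'[ofUpperHalfPlane UpperHalfPlane.I] (((1 : GaussianInt) : ℂ) / 7) / (2 * ((Real.Gamma (1 / 4) ^ 2 / (2 * Real.sqrt (2 * Real.pi)) : ℝ) : ℂ) ^ 3))) ^ m := by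
  obtain ⟨hr0, hr1⟩ := val_t_lt_one v h7 not_seven_dvd_one
  obtain ⟨a, rfl⟩ := exists_coeff_pow v h7 x
  rw [coe_sum_smul_pow, coe_t]
  refine exists_zpow_of_sum_ne_zero v hr0 hr1 rfl _ (val_coeff_mem v h7 a) ?_
  intro h0
  apply hx
  apply Subtype.ext
  rw [coe_sum_smul_pow, coe_t]
  exact h0

/-- **The tame character has exact order `48`**: if `v((σt_1/t_1)^m − 1) < 1` for every `σ ∈ Gal(K₇/ℚ(i))`, then `48 ∣ m`
(take `σ = σ_{2+i}` from `…SevenDivisionGaloisCount.card_algEquiv`). [cite: Serre1979, Ch. IV §2 Prop. 7] -/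
theorem dvd_fortyEight_of_forall_algEquiv (h7 : v 7 < 1) {m : ℤ}
    (hm : ∀ σ : (IntermediateField.adjoin ℚ⟮I⟯ {x : ℂ | ∃ c : GaussianInt, ¬ (7 : GaussianInt) ∣ c ∧
        (x = ℘[ofUpperHalfPlane UpperHalfPlane.I] (((c : GaussianInt) : ℂ) / 7) / ((Real.Gamma (1 / 4) ^ 2 / (2 * Real.sqrt (2 * Real.pi)) : ℝ) : ℂ) ^ 2 ∨
         x = ℘'[ofUpperHalfPlane UpperHalfPlane.I] (((c : GaussianInt) : ℂ) / 7) / (2 * ((Real.Gamma (1 / 4) ^ 2 / (2 * Real.sqrt (2 * Real.pi)) : ℝ) : ℂ) ^ 3))}) ≃ₐ[ℚ⟮I⟯]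
             (IntermediateField.adjoin ℚ⟮I⟯ {x : ℂ | ∃ c : GaussianInt, ¬ (7 : GaussianInt) ∣ c ∧
        (x = ℘[ofUpperHalfPlane UpperHalfPlane.I] (((c : GaussianInt) : ℂ) / 7) / ((Real.Gamma (1 / 4) ^ 2 / (2 * Real.sqrt (2 * Real.pi)) : ℝ) : ℂ) ^ 2 ∨
         x = ℘'[ofUpperHalfPlane UpperHalfPlane.I] (((c : GaussianInt) : ℂ) / 7) / (2 * ((Real.Gamma (1 / 4) ^ 2 / (2 * Real.sqrt (2 * Real.pi)) : ℝ) : ℂ) ^ 3))}), v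
             ((((σ ((⟨_, X_mem_adjoin not_seven_dvd_one⟩ : (IntermediateField.adjoin ℚ⟮I⟯ {x : ℂ | ∃ c : GaussianInt, ¬ (7 : GaussianInt) ∣ c ∧
        (x = ℘[ofUpperHalfPlane UpperHalfPlane.I] (((c : GaussianInt) : ℂ) / 7) / ((Real.Gamma (1 / 4) ^ 2 / (2 * Real.sqrt (2 * Real.pi)) : ℝ) : ℂ) ^ 2 ∨
         x = ℘'[ofUpperHalfPlane UpperHalfPlane.I] (((c : GaussianInt) : ℂ) / 7) / (2 * ((Real.Gamma (1 / 4) ^ 2 / (2 * Real.sqrt (2 * Real.pi)) : ℝ) : ℂ) ^ 3))})) /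
             ⟨_, Y_mem_adjoin not_seven_dvd_one⟩) /
        ((⟨_, X_mem_adjoin not_seven_dvd_one⟩ : (IntermediateField.adjoin ℚ⟮I⟯ {x : ℂ | ∃ c : GaussianInt, ¬ (7 : GaussianInt) ∣ c ∧
        (x = ℘[ofUpperHalfPlane UpperHalfPlane.I] (((c : GaussianInt) : ℂ) / 7) / ((Real.Gamma (1 / 4) ^ 2 / (2 * Real.sqrt (2 * Real.pi)) : ℝ) : ℂ) ^ 2 ∨
         x = ℘'[ofUpperHalfPlane UpperHalfPlane.I] (((c : GaussianInt) : ℂ) / 7) / (2 * ((Real.Gamma (1 / 4) ^ 2 / (2 * Real.sqrt (2 * Real.pi)) : ℝ) : ℂ) ^ 3))})) /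
             ⟨_, Y_mem_adjoin not_seven_dvd_one⟩)) ^ m - 1 : (IntermediateField.adjoin ℚ⟮I⟯ {x : ℂ | ∃ c : GaussianInt, ¬ (7 : GaussianInt) ∣ c ∧
        (x = ℘[ofUpperHalfPlane UpperHalfPlane.I] (((c : GaussianInt) : ℂ) / 7) / ((Real.Gamma (1 / 4) ^ 2 / (2 * Real.sqrt (2 * Real.pi)) : ℝ) : ℂ) ^ 2 ∨
         x = ℘'[ofUpperHalfPlane UpperHalfPlane.I] (((c : GaussianInt) : ℂ) / 7) / (2 * ((Real.Gamma (1 / 4) ^ 2 / (2 * Real.sqrt (2 * Real.pi)) : ℝ) : ℂ) ^ 3))}))) : ℂ) < 1) :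
    (48 : ℤ) ∣ m := by
  obtain ⟨-, -, hsurj⟩ := card_algEquiv v h7
  have hg7 : ¬ (7 : GaussianInt) ∣ (⟨2, 1⟩ : GaussianInt) := fun h ↦ by
    have := (seven_dvd_iff _).mp h; norm_num at this
  obtain ⟨σg, hσg⟩ := hsurj ⟨2, 1⟩ hg7
  have hσgX : ((σg ⟨_, X_mem_adjoin not_seven_dvd_one⟩ : (IntermediateField.adjoin ℚ⟮I⟯ {x : ℂ | ∃ c : GaussianInt, ¬ (7 : GaussianInt) ∣ c ∧
        (x = ℘[ofUpperHalfPlane UpperHalfPlane.I] (((c : GaussianInt) : ℂ) / 7) / ((Real.Gamma (1 / 4) ^ 2 / (2 * Real.sqrt (2 * Real.pi)) : ℝ) : ℂ) ^ 2 ∨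
         x = ℘'[ofUpperHalfPlane UpperHalfPlane.I] (((c : GaussianInt) : ℂ) / 7) / (2 * ((Real.Gamma (1 / 4) ^ 2 / (2 * Real.sqrt (2 * Real.pi)) : ℝ) : ℂ) ^ 3))})) : ℂ) =
             (℘[ofUpperHalfPlane UpperHalfPlane.I] ((((⟨2, 1⟩ : GaussianInt) : GaussianInt) : ℂ) / 7) / ((Real.Gamma (1 / 4) ^ 2 / (2 * Real.sqrt (2 * Real.pi)) : ℝ) : ℂ) ^ 2) := by
    have h := (hσg 1 not_seven_dvd_one).1; rwa [mul_one] at h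
  have hσgY : ((σg ⟨_, Y_mem_adjoin not_seven_dvd_one⟩ : (IntermediateField.adjoin ℚ⟮I⟯ {x : ℂ | ∃ c : GaussianInt, ¬ (7 : GaussianInt) ∣ c ∧
        (x = ℘[ofUpperHalfPlane UpperHalfPlane.I] (((c : GaussianInt) : ℂ) / 7) / ((Real.Gamma (1 / 4) ^ 2 / (2 * Real.sqrt (2 * Real.pi)) : ℝ) : ℂ) ^ 2 ∨
         x = ℘'[ofUpperHalfPlane UpperHalfPlane.I] (((c : GaussianInt) : ℂ) / 7) / (2 * ((Real.Gamma (1 / 4) ^ 2 / (2 * Real.sqrt (2 * Real.pi)) : ℝ) : ℂ) ^ 3))})) : ℂ) =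
             (℘'[ofUpperHalfPlane UpperHalfPlane.I] ((((⟨2, 1⟩ : GaussianInt) : GaussianInt) : ℂ) / 7) / (2 * ((Real.Gamma (1 / 4) ^ 2 / (2 * Real.sqrt (2 * Real.pi)) : ℝ) : ℂ) ^ 3)) := by
    have h := (hσg 1 not_seven_dvd_one).2; rwa [mul_one] at h
  have hθ := hm σg
  have hzpow : ((((σg ((⟨_, X_mem_adjoin not_seven_dvd_one⟩ : (IntermediateField.adjoin ℚ⟮I⟯ {x : ℂ | ∃ c : GaussianInt, ¬ (7 : GaussianInt) ∣ c ∧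
        (x = ℘[ofUpperHalfPlane UpperHalfPlane.I] (((c : GaussianInt) : ℂ) / 7) / ((Real.Gamma (1 / 4) ^ 2 / (2 * Real.sqrt (2 * Real.pi)) : ℝ) : ℂ) ^ 2 ∨
         x = ℘'[ofUpperHalfPlane UpperHalfPlane.I] (((c : GaussianInt) : ℂ) / 7) / (2 * ((Real.Gamma (1 / 4) ^ 2 / (2 * Real.sqrt (2 * Real.pi)) : ℝ) : ℂ) ^ 3))})) /
             ⟨_, Y_mem_adjoin not_seven_dvd_one⟩) /
      ((⟨_, X_mem_adjoin not_seven_dvd_one⟩ : (IntermediateField.adjoin ℚ⟮I⟯ {x : ℂ | ∃ c : GaussianInt, ¬ (7 : GaussianInt) ∣ c ∧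
        (x = ℘[ofUpperHalfPlane UpperHalfPlane.I] (((c : GaussianInt) : ℂ) / 7) / ((Real.Gamma (1 / 4) ^ 2 / (2 * Real.sqrt (2 * Real.pi)) : ℝ) : ℂ) ^ 2 ∨
         x = ℘'[ofUpperHalfPlane UpperHalfPlane.I] (((c : GaussianInt) : ℂ) / 7) / (2 * ((Real.Gamma (1 / 4) ^ 2 / (2 * Real.sqrt (2 * Real.pi)) : ℝ) : ℂ) ^ 3))})) /
             ⟨_, Y_mem_adjoin not_seven_dvd_one⟩)) ^ m : (IntermediateField.adjoin ℚ⟮I⟯ {x : ℂ | ∃ c : GaussianInt, ¬ (7 : GaussianInt) ∣ c ∧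
        (x = ℘[ofUpperHalfPlane UpperHalfPlane.I] (((c : GaussianInt) : ℂ) / 7) / ((Real.Gamma (1 / 4) ^ 2 / (2 * Real.sqrt (2 * Real.pi)) : ℝ) : ℂ) ^ 2 ∨
         x = ℘'[ofUpperHalfPlane UpperHalfPlane.I] (((c : GaussianInt) : ℂ) / 7) / (2 * ((Real.Gamma (1 / 4) ^ 2 / (2 * Real.sqrt (2 * Real.pi)) : ℝ) : ℂ) ^ 3))}))) : ℂ) =
      ((((σg ((⟨_, X_mem_adjoin not_seven_dvd_one⟩ : (IntermediateField.adjoin ℚ⟮I⟯ {x : ℂ | ∃ c : GaussianInt, ¬ (7 : GaussianInt) ∣ c ∧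
        (x = ℘[ofUpperHalfPlane UpperHalfPlane.I] (((c : GaussianInt) : ℂ) / 7) / ((Real.Gamma (1 / 4) ^ 2 / (2 * Real.sqrt (2 * Real.pi)) : ℝ) : ℂ) ^ 2 ∨
         x = ℘'[ofUpperHalfPlane UpperHalfPlane.I] (((c : GaussianInt) : ℂ) / 7) / (2 * ((Real.Gamma (1 / 4) ^ 2 / (2 * Real.sqrt (2 * Real.pi)) : ℝ) : ℂ) ^ 3))})) /
             ⟨_, Y_mem_adjoin not_seven_dvd_one⟩) /
      ((⟨_, X_mem_adjoin not_seven_dvd_one⟩ : (IntermediateField.adjoin ℚ⟮I⟯ {x : ℂ | ∃ c : GaussianInt, ¬ (7 : GaussianInt) ∣ c ∧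
        (x = ℘[ofUpperHalfPlane UpperHalfPlane.I] (((c : GaussianInt) : ℂ) / 7) / ((Real.Gamma (1 / 4) ^ 2 / (2 * Real.sqrt (2 * Real.pi)) : ℝ) : ℂ) ^ 2 ∨
         x = ℘'[ofUpperHalfPlane UpperHalfPlane.I] (((c : GaussianInt) : ℂ) / 7) / (2 * ((Real.Gamma (1 / 4) ^ 2 / (2 * Real.sqrt (2 * Real.pi)) : ℝ) : ℂ) ^ 3))})) /
             ⟨_, Y_mem_adjoin not_seven_dvd_one⟩)) : (IntermediateField.adjoin ℚ⟮I⟯ {x : ℂ | ∃ c : GaussianInt, ¬ (7 : GaussianInt) ∣ c ∧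
        (x = ℘[ofUpperHalfPlane UpperHalfPlane.I] (((c : GaussianInt) : ℂ) / 7) / ((Real.Gamma (1 / 4) ^ 2 / (2 * Real.sqrt (2 * Real.pi)) : ℝ) : ℂ) ^ 2 ∨
         x = ℘'[ofUpperHalfPlane UpperHalfPlane.I] (((c : GaussianInt) : ℂ) / 7) / (2 * ((Real.Gamma (1 / 4) ^ 2 / (2 * Real.sqrt (2 * Real.pi)) : ℝ) : ℂ) ^ 3))}))) : ℂ) ^ m :=
    map_zpow₀ (algebraMap (IntermediateField.adjoin ℚ⟮I⟯ {x : ℂ | ∃ c : GaussianInt, ¬ (7 : GaussianInt) ∣ c ∧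
        (x = ℘[ofUpperHalfPlane UpperHalfPlane.I] (((c : GaussianInt) : ℂ) / 7) / ((Real.Gamma (1 / 4) ^ 2 / (2 * Real.sqrt (2 * Real.pi)) : ℝ) : ℂ) ^ 2 ∨
         x = ℘'[ofUpperHalfPlane UpperHalfPlane.I] (((c : GaussianInt) : ℂ) / 7) / (2 * ((Real.Gamma (1 / 4) ^ 2 / (2 * Real.sqrt (2 * Real.pi)) : ℝ) : ℂ) ^ 3))}) ℂ) _ m
  rw [AddSubgroupClass.coe_sub, IntermediateField.coe_one, hzpow, IntermediateField.coe_div, coe_algEquiv_t σg hσgX hσgY,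
    coe_t] at hθ
  exact dvd_fortyEight_of_val_theta_zpow v h7 hθ

end Isometry

end Summit.BirchSwinnertonDyer.BirchSwinnertonDyer.Theorems.BiquadraticEisensteinDescentManinDatumSupercuspidalCMInertSevenDivisionResolventIsometry

end
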